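import Summits.CriticalPhenomena.PercolationContinuityZ3.Theorems.PercNearOneGluingNoHeavyLowerTailSahiOneStepGoodPivot
import HarnessLib

/-!
# One-step scheme: `(2′)` for ALL pairs of increasing events from the GOOD-PIVOT property

Prover prim-ineq-prove-3 gen 27 (`--supports stmt-CriticalPhenomena-4575`; memo
`run/shared/lean/prim/prim-ineq-prove-3/FINDING-G27-PIVOT-CERTIFICATE.md` §3–4).  No definitions, no sorries.

By the good-pivot step (`osN_threshold_goodPivot_step`) and strong induction on the block: if every increasing event `B` admits, for
every nonempty block `F` and level `t`, a counted pivot `e ∈ F` with `X̃_B(e) ≥ 0` (the pivot helps `B` inside the ball `{N < t+1}` —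
such a pivot ALWAYS exists: `Σ_e Cov_ball(1_B, x_e) = Cov_ball(1_B, N_F) ≥ 0` by layer monotonicity) and `Ψ_B(e) ≥ 0`, then
`n_{N_F ≥ t}(A,B) ≥ 0` — i.e. `Cov(A,B) ≥ μ(N_F < t)·Cov(A,B ∣ N_F < t)` — for EVERY block, level, product measure and ALL increasing
`A, B` (`osN_threshold_nonneg_of_goodPivots`), hence Kahn C5 / Sahi `C₃` with a threshold first slot (`sahiE3_threshold_nonneg_of_goodPivots`).
The good-pivot property holds in every numerical test (all up-sets of `{0,1}^n`, `n ≤ 5`, many density vectors; random `n ≤ 9`) and is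
PROVED for nested block thresholds (memo §2); it fails for no known event.  This file records the reduction in the kernel.
-/

noncomputable section

namespace Summit.CriticalPhenomena.PercolationContinuityZ3.Theorems

namespace SahiOneStep

open MeasureTheory Finset
open Literature.Probability.LatticeModels (prodBernoulli sahiE3)
open Literature.Probability.Percolation.DecisionTree (ind)
open scoped Classical

variable {ι : Type*} [Fintype ι]

/-! ## `(2′)` for all pairs from the GOOD-PIVOT property -/

/-- **REDUCTION OF `(2′)` (ALL PRODUCT MEASURES, ALL PAIRS) TO THE GOOD-PIVOT PROPERTY.**  Suppose that for every nonempty block `F`,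
every level `t` and every increasing `B` there is a counted pivot `e ∈ F` which is GOOD for `B` at `(F ∖ e, t)`:
`X̃_B(e) ≥ 0` (the pivot helps `B` inside the ball — such a pivot always exists, memo §3) and `Ψ_B(e) ≥ 0`.  Then
`n_{N_F ≥ t}(A,B) ≥ 0` for EVERY block `F`, level `t` and ALL increasing `A, B`. [this work] -/
theorem osN_threshold_nonneg_of_goodPivots (p : ι → unitInterval)
    (hgood : ∀ (F : Finset ι) (t : ℕ) (B : Set (Set ι)), F.Nonempty → IsUpperSet B → ∃ e ∈ F,
      (prodBernoulli p).real {ω : Set ι | ((F.erase e).filter (· ∈ ω)).card < t} *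
          (prodBernoulli p).real ({ω : Set ι | ω \ {e} ∈ B} ∩ {ω : Set ι | ((F.erase e).filter (· ∈ ω)).card < t + 1}) ≤
        (prodBernoulli p).real {ω : Set ι | ((F.erase e).filter (· ∈ ω)).card < t + 1} *
          (prodBernoulli p).real ({ω : Set ι | insert e ω ∈ B} ∩ {ω : Set ι | ((F.erase e).filter (· ∈ ω)).card < t}) ∧
      (prodBernoulli p).real {ω : Set ι | ((F.erase e).filter (· ∈ ω)).card < t} *
          (1 - (prodBernoulli p).real {ω : Set ι | insert e ω ∈ B}) *
          ((prodBernoulli p).real {ω : Set ι | ((F.erase e).filter (· ∈ ω)).card < t + 1} *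
              (prodBernoulli p).real {ω : Set ι | ω \ {e} ∈ B}
            - (prodBernoulli p).real ({ω : Set ι | ω \ {e} ∈ B} ∩ {ω : Set ι | ((F.erase e).filter (· ∈ ω)).card < t + 1})) ≤
        (prodBernoulli p).real {ω : Set ι | ((F.erase e).filter (· ∈ ω)).card < t + 1} *
          (1 - (prodBernoulli p).real {ω : Set ι | ω \ {e} ∈ B}) *
          ((prodBernoulli p).real {ω : Set ι | ((F.erase e).filter (· ∈ ω)).card < t} *
              (prodBernoulli p).real {ω : Set ι | insert e ω ∈ B}
            - (prodBernoulli p).real ({ω : Set ι | insert e ω ∈ B} ∩ {ω : Set ι | ((F.erase e).filter (· ∈ ω)).card < t})))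
    (F : Finset ι) (t : ℕ) {A B : Set (Set ι)} (hA : IsUpperSet A) (hB : IsUpperSet B) :
    0 ≤ osN p {ω : Set ι | t ≤ (F.filter (· ∈ ω)).card} (ind A) (ind B) := by
  induction hn : F.card using Nat.strong_induction_on generalizing F t A B with
  | _ n ih =>
  cases t with
  | zero => rw [threshold_zero, osN_ind_ind_univ]
  | succ t =>
    rcases F.eq_empty_or_nonempty with hF | hF
    · subst hF; rw [threshold_empty_succ, osN_ind_ind_empty]
    · obtain ⟨e, heF, hX, hΨ⟩ := hgood F t B hF hB
      have hF' : F = insert e (F.erase e) := (Finset.insert_erase heF).symm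
      have hcard : (F.erase e).card < n := by rw [← hn]; exact Finset.card_erase_lt_of_mem heF
      rw [hF']
      refine osN_threshold_goodPivot_step p (F.notMem_erase e) t hA hB ?_ ?_ ?_ hX hΨ
      · exact ih _ hcard (F.erase e) t (isUpperSet_section_insert hA e) (isUpperSet_section_insert hB e) rfl
      · exact ih _ hcard (F.erase e) (t + 1) (isUpperSet_section_insert hA e) (isUpperSet_section_sdiff hB e) rfl
      · exact ih _ hcard (F.erase e) (t + 1) (isUpperSet_section_sdiff hA e) (isUpperSet_section_sdiff hB e) rfl

/-- **KAHN C5 / SAHI `C₃` FOR A THRESHOLD FIRST SLOT, ALL PAIRS, FROM THE GOOD-PIVOT PROPERTY.**  Under the hypothesis of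
`osN_threshold_nonneg_of_goodPivots`: `0 ≤ E₃(1_{N_F ≥ t}, 1_A, 1_B)` for every product measure, every block `F`, level `t`
and ALL increasing `A, B`. [this work] -/
theorem sahiE3_threshold_nonneg_of_goodPivots (p : ι → unitInterval)
    (hgood : ∀ (F : Finset ι) (t : ℕ) (B : Set (Set ι)), F.Nonempty → IsUpperSet B → ∃ e ∈ F,
      (prodBernoulli p).real {ω : Set ι | ((F.erase e).filter (· ∈ ω)).card < t} *
          (prodBernoulli p).real ({ω : Set ι | ω \ {e} ∈ B} ∩ {ω : Set ι | ((F.erase e).filter (· ∈ ω)).card < t + 1}) ≤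
        (prodBernoulli p).real {ω : Set ι | ((F.erase e).filter (· ∈ ω)).card < t + 1} *
          (prodBernoulli p).real ({ω : Set ι | insert e ω ∈ B} ∩ {ω : Set ι | ((F.erase e).filter (· ∈ ω)).card < t}) ∧
      (prodBernoulli p).real {ω : Set ι | ((F.erase e).filter (· ∈ ω)).card < t} *
          (1 - (prodBernoulli p).real {ω : Set ι | insert e ω ∈ B}) *
          ((prodBernoulli p).real {ω : Set ι | ((F.erase e).filter (· ∈ ω)).card < t + 1} *
              (prodBernoulli p).real {ω : Set ι | ω \ {e} ∈ B}
            - (prodBernoulli p).real ({ω : Set ι | ω \ {e} ∈ B} ∩ {ω : Set ι | ((F.erase e).filter (· ∈ ω)).card < t + 1})) ≤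
        (prodBernoulli p).real {ω : Set ι | ((F.erase e).filter (· ∈ ω)).card < t + 1} *
          (1 - (prodBernoulli p).real {ω : Set ι | ω \ {e} ∈ B}) *
          ((prodBernoulli p).real {ω : Set ι | ((F.erase e).filter (· ∈ ω)).card < t} *
              (prodBernoulli p).real {ω : Set ι | insert e ω ∈ B}
            - (prodBernoulli p).real ({ω : Set ι | insert e ω ∈ B} ∩ {ω : Set ι | ((F.erase e).filter (· ∈ ω)).card < t})))
    (F : Finset ι) (t : ℕ) {A B : Set (Set ι)} (hA : IsUpperSet A) (hB : IsUpperSet B) :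
    0 ≤ sahiE3 (prodBernoulli p) {ω : Set ι | t ≤ (F.filter (· ∈ ω)).card} A B := by
  rw [← osT_ind_ind, osT_eq_osMp_add_osN]
  exact add_nonneg (osMp_threshold_nonneg_all p F t hA hB) (osN_threshold_nonneg_of_goodPivots p hgood F t hA hB)

/-! ## The reduction with the hypothesis restricted to events determined by the slot block

The hypothesis of `osN_threshold_nonneg_of_goodPivots` quantifies over ALL increasing `B`; numerically the good-pivot property can fail for
events depending on coordinates outside the slot block `F` (memo §0(vi)), so that form is not expected to be dischargeable.  The versions
below ask for good pivots only for `B` DETERMINED BY `F` — the form supported by every test (all up-sets of `{0,1}^n`, `n ≤ 5`; `1.3·10⁵`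
random events, `n ≤ 9`; kit j182964) — and still conclude `(2′)` for ALL pairs: the coordinates outside `F` are peeled by the free-coordinate
extension `osMp_osN_nonneg_of_determined`. -/

open Literature.Probability.Percolation (DeterminedBy)
open SahiE3Sections (determinedBy_section_insert determinedBy_section_sdiff)

/-- **REDUCTION OF `(2′)` (ALL PRODUCT MEASURES, ALL PAIRS) TO THE GOOD-PIVOT PROPERTY OF `F`-DETERMINED EVENTS.**  Suppose that for every nonempty block `F`,
every level `t` and every increasing `B` DETERMINED BY `F` there is a counted pivot `e ∈ F` which is GOOD for `B` at `(F ∖ e, t)`: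
`X̃_B(e) ≥ 0` (the pivot helps `B` inside the ball — such a pivot always exists, memo §0(iv)) and `Ψ_B(e) ≥ 0` (memo §0(vi): holds in
every test; the restriction to `F`-determined `B` is necessary).  Then `n_{N_F ≥ t}(A,B) ≥ 0` for EVERY block `F`, level `t` and ALL
increasing `A, B` (not necessarily determined by `F`: free coordinates are peeled by `osMp_osN_nonneg_of_determined`). [this work] -/
theorem osN_threshold_nonneg_of_goodPivots_det (p : ι → unitInterval)
    (hgood : ∀ (F : Finset ι) (t : ℕ) (B : Set (Set ι)), F.Nonempty → IsUpperSet B → DeterminedBy B (↑F : Set ι) → ∃ e ∈ F,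
      (prodBernoulli p).real {ω : Set ι | ((F.erase e).filter (· ∈ ω)).card < t} *
          (prodBernoulli p).real ({ω : Set ι | ω \ {e} ∈ B} ∩ {ω : Set ι | ((F.erase e).filter (· ∈ ω)).card < t + 1}) ≤
        (prodBernoulli p).real {ω : Set ι | ((F.erase e).filter (· ∈ ω)).card < t + 1} *
          (prodBernoulli p).real ({ω : Set ι | insert e ω ∈ B} ∩ {ω : Set ι | ((F.erase e).filter (· ∈ ω)).card < t}) ∧
      (prodBernoulli p).real {ω : Set ι | ((F.erase e).filter (· ∈ ω)).card < t} *
          (1 - (prodBernoulli p).real {ω : Set ι | insert e ω ∈ B}) *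
          ((prodBernoulli p).real {ω : Set ι | ((F.erase e).filter (· ∈ ω)).card < t + 1} *
              (prodBernoulli p).real {ω : Set ι | ω \ {e} ∈ B}
            - (prodBernoulli p).real ({ω : Set ι | ω \ {e} ∈ B} ∩ {ω : Set ι | ((F.erase e).filter (· ∈ ω)).card < t + 1})) ≤
        (prodBernoulli p).real {ω : Set ι | ((F.erase e).filter (· ∈ ω)).card < t + 1} *
          (1 - (prodBernoulli p).real {ω : Set ι | ω \ {e} ∈ B}) *
          ((prodBernoulli p).real {ω : Set ι | ((F.erase e).filter (· ∈ ω)).card < t} *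
              (prodBernoulli p).real {ω : Set ι | insert e ω ∈ B}
            - (prodBernoulli p).real ({ω : Set ι | insert e ω ∈ B} ∩ {ω : Set ι | ((F.erase e).filter (· ∈ ω)).card < t})))
    (F : Finset ι) (t : ℕ) {A B : Set (Set ι)} (hA : IsUpperSet A) (hB : IsUpperSet B) :
    0 ≤ osN p {ω : Set ι | t ≤ (F.filter (· ∈ ω)).card} (ind A) (ind B) := by
  -- Step 1: `B` determined by `F` (and `A` arbitrary), by strong induction on `#F`.
  have key : ∀ (n : ℕ) (F : Finset ι), F.card = n → ∀ (t : ℕ) (A B : Set (Set ι)), IsUpperSet A → IsUpperSet B →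
      DeterminedBy B (↑F : Set ι) → 0 ≤ osN p {ω : Set ι | t ≤ (F.filter (· ∈ ω)).card} (ind A) (ind B) := by
    intro n
    induction n using Nat.strong_induction_on with
    | _ n ih =>
    intro F hn t A B hA hB hBF
    cases t with
    | zero => rw [threshold_zero, osN_ind_ind_univ]
    | succ t =>
      rcases F.eq_empty_or_nonempty with hF | hF
      · subst hF; rw [threshold_empty_succ, osN_ind_ind_empty]
      · obtain ⟨e, heF, hX, hΨ⟩ := hgood F t B hF hB hBF
        have hF' : F = insert e (F.erase e) := (Finset.insert_erase heF).symm
        have hcard : (F.erase e).card < n := by rw [← hn]; exact Finset.card_erase_lt_of_mem heF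
        have hcoe : (↑F : Set ι) \ {e} = ↑(F.erase e) := by rw [Finset.coe_erase]
        have hB1 : DeterminedBy {ω : Set ι | insert e ω ∈ B} (↑(F.erase e) : Set ι) := hcoe ▸ determinedBy_section_insert hBF e
        have hB0 : DeterminedBy {ω : Set ι | ω \ {e} ∈ B} (↑(F.erase e) : Set ι) := hcoe ▸ determinedBy_section_sdiff hBF e
        rw [hF']
        refine osN_threshold_goodPivot_step p (F.notMem_erase e) t hA hB ?_ ?_ ?_ hX hΨ
        · exact ih _ hcard (F.erase e) rfl t _ _ (isUpperSet_section_insert hA e) (isUpperSet_section_insert hB e) hB1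
        · exact ih _ hcard (F.erase e) rfl (t + 1) _ _ (isUpperSet_section_insert hA e) (isUpperSet_section_sdiff hB e) hB0
        · exact ih _ hcard (F.erase e) rfl (t + 1) _ _ (isUpperSet_section_sdiff hA e) (isUpperSet_section_sdiff hB e) hB0
  -- Step 2: peel the coordinates outside `F` (free-coordinate extension).
  exact (osMp_osN_nonneg_of_determined p (determinedBy_threshold F t)
    (fun A' B' hA' hB' _ _ => osMp_threshold_nonneg_all p F t hA' hB')
    (fun A' B' hA' hB' _ hB'F => key _ F rfl t A' B' hA' hB' hB'F) hA hB).2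

/-- **KAHN C5 / SAHI `C₃` FOR A THRESHOLD FIRST SLOT, ALL PAIRS, FROM THE GOOD-PIVOT PROPERTY OF `F`-DETERMINED EVENTS.**  Under the hypothesis of
`osN_threshold_nonneg_of_goodPivots_det`: `0 ≤ E₃(1_{N_F ≥ t}, 1_A, 1_B)` for every product measure, every block `F`, level `t`
and ALL increasing `A, B`. [this work] -/
theorem sahiE3_threshold_nonneg_of_goodPivots_det (p : ι → unitInterval)
    (hgood : ∀ (F : Finset ι) (t : ℕ) (B : Set (Set ι)), F.Nonempty → IsUpperSet B → DeterminedBy B (↑F : Set ι) → ∃ e ∈ F,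
      (prodBernoulli p).real {ω : Set ι | ((F.erase e).filter (· ∈ ω)).card < t} *
          (prodBernoulli p).real ({ω : Set ι | ω \ {e} ∈ B} ∩ {ω : Set ι | ((F.erase e).filter (· ∈ ω)).card < t + 1}) ≤
        (prodBernoulli p).real {ω : Set ι | ((F.erase e).filter (· ∈ ω)).card < t + 1} *
          (prodBernoulli p).real ({ω : Set ι | insert e ω ∈ B} ∩ {ω : Set ι | ((F.erase e).filter (· ∈ ω)).card < t}) ∧
      (prodBernoulli p).real {ω : Set ι | ((F.erase e).filter (· ∈ ω)).card < t} *
          (1 - (prodBernoulli p).real {ω : Set ι | insert e ω ∈ B}) *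
          ((prodBernoulli p).real {ω : Set ι | ((F.erase e).filter (· ∈ ω)).card < t + 1} *
              (prodBernoulli p).real {ω : Set ι | ω \ {e} ∈ B}
            - (prodBernoulli p).real ({ω : Set ι | ω \ {e} ∈ B} ∩ {ω : Set ι | ((F.erase e).filter (· ∈ ω)).card < t + 1})) ≤
        (prodBernoulli p).real {ω : Set ι | ((F.erase e).filter (· ∈ ω)).card < t + 1} *
          (1 - (prodBernoulli p).real {ω : Set ι | ω \ {e} ∈ B}) *
          ((prodBernoulli p).real {ω : Set ι | ((F.erase e).filter (· ∈ ω)).card < t} *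
              (prodBernoulli p).real {ω : Set ι | insert e ω ∈ B}
            - (prodBernoulli p).real ({ω : Set ι | insert e ω ∈ B} ∩ {ω : Set ι | ((F.erase e).filter (· ∈ ω)).card < t})))
    (F : Finset ι) (t : ℕ) {A B : Set (Set ι)} (hA : IsUpperSet A) (hB : IsUpperSet B) :
    0 ≤ sahiE3 (prodBernoulli p) {ω : Set ι | t ≤ (F.filter (· ∈ ω)).card} A B := by
  rw [← osT_ind_ind, osT_eq_osMp_add_osN]
  exact add_nonneg (osMp_threshold_nonneg_all p F t hA hB) (osN_threshold_nonneg_of_goodPivots_det p hgood F t hA hB)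

end SahiOneStep

end Summit.CriticalPhenomena.PercolationContinuityZ3.Theorems
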